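import Summits.BirchSwinnertonDyer.BirchSwinnertonDyer.Theorems.KolyvaginRoadThreeMethod2InductionOfLevelSystemsDict
import Summits.BirchSwinnertonDyer.BirchSwinnertonDyer.Theorems.KolyvaginRoadThreeMethod2LocalDictionaries
import Summits.BirchSwinnertonDyer.BirchSwinnertonDyer.Theorems.KolyvaginRoadThreeMethod2TransverseStrict
import Summits.BirchSwinnertonDyer.BirchSwinnertonDyer.Theorems.KolyvaginRoadThreeMethod2ChebOfMcCallum
import HarnessLib

/-!
# KOLY method line, crux stmt-BirchSwinnertonDyer-19574 `ZhangSharpFrameAtThreeHL`: the proposed stub S2-ENGINE REDUCED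
# to the local Tate-pairing package + (Line) + (Supply) over the GENUINE localisation maps (cell `bsd-stepL`, seat
# `bsd-stepL-zhang3-p1` g8; `--supports 19574`, helper; v3 re-line, memo `HOME/zhang3/S2-RELINE-19574.md` §2)

HONEST FRAMING. One theorem; 0 definitions, 0 named facts, 0 `sorry`; CONDITIONAL on every binder; closes nothing (T7).
PARTITION: O2@3 (B10) × A1 × crux 19574 × stub S2 (proposed S2-ENGINE) — types-the-object-of.

WHAT. `Method2.inductionOfLevelSystems_of_localGlobal`: at an HL-type frame (`K` imaginary quadratic, complex
conjugation `c ≠ 1`, `ρ̄_{E,3}` onto, multiplicative reduction at `3`), a `LevelKolyvaginSystem` + stub A's (A1) +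
`dim Sel₃(E/K)` odd `≥ 3` ⟹ a non-zero Kolyvagin class of the frame, GIVEN ONLY: the genuine localisations
`loc v = galoisCohomology.localization ρ v 1` (as `ZMod 3`-linear maps, `hloc`), the places `plK`/`plU` of the
Kolyvagin /
unipotent-admissible primes, and the LEVEL-SYSTEM-FREE local–global package — a family of `ZMod 3`-bilinear local forms
`b v` on `H¹(K_v, E[3])` with (REC) reciprocity, isotropy of the Kummer conditions (`kummerLocalConditionAt`), of the
ordinary conditions (images of `ordinaryLocalKer`) and of the transverse conditions (images of `transverseLocalKer`),
(Perf) `Kummer^s × transverse^s` non-degenerate at Kolyvagin primes; (Line) the Kummer eigen-line at Kolyvagin primes;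
(Supply) Zhang's Lemma 8.2 for the level structures. DISCHARGED inside (tree theorems of this seat and others): the
dictionary layer (p499103), the per-place dictionaries (p501309: `mem_torsionLocalKer_iff_res_eq_zero`,
`comap_res_kummerLocalConditionAt`), `torsionLocalKer ≤ transverseLocalKer` (p501858), (Cheb) ×2 from McCallum's
Cor. 3.2 (p500469, tree THEOREM `McCallum1991_cor_3_2_eigen_holds`), the eigenspace dictionary, the level structure.
So after this file the proposed stub S2-ENGINE = {local Tate pairing package for `E[3]` over `K` (Milne I.2.3 ∕ I.4.10,
Poonen–Rains, koly g13's `IsoOrdinary`), (Line), (Supply) (koly3b g4)} — all E-side, all in print.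

References: [cite: WZhang2014, §8.1, Lemma 8.1, Lemma 8.2, Lemma 8.4, §9] [cite: McCallumLMS1991, Prop. 3.1, Cor. 3.2,
Lemma 5.3] [cite: MilneADT2006, Ch. I, Cor. 2.3, Thm. 4.10] [cite: PoonenRains2012, Prop. 4.10].
-/

noncomputable section

open scoped Classical

namespace Summit.BirchSwinnertonDyer.Rank1Residual.X11b.Three.Koly.Method2

open WeierstrassCurve NumberField IsDedekindDomain
  Literature.NumberTheory.EllipticCurves Literature.NumberTheory.EllipticCurves.ModularForms
  Literature.NumberTheory.GaloisRepresentations Module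

variable (W : WeierstrassCurve ℚ) (K : Type) [Field K] [NumberField K]
variable [W.IsElliptic] [W.IsGloballyMinimal] [NeZero (W.conductorNorm ℤ)]
  (Dt : ModularParametrizationData W (W.conductorNorm ℤ)) (β : ℤ) (ι : K →+* ℂ) (c : K ≃ₐ[ℚ] K)
  [Module (ZMod 3) (V3 W K)]
  [∀ v : Place K, Module (ZMod 3)
    (galoisCohomology (((W.baseChange K).torsionGaloisModule ((3 ^ 1 : ℕ) : ℤ)).toLocal v) 1)]

/-- **S2-ENGINE reduced to the local Tate-pairing package + (Line) + (Supply), over the genuine localisations.**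
See the module docstring. Binders: frame facts `hK`, `hmult`, `hsurj`, `hc`; the level system `S`; the localisations
`loc` with `hloc : loc v x = galoisCohomology.localization ρ v 1 x`; the places `plK`, `plU` (`hplK`, `hplU`); bilinear
local forms `b` with (REC) `hrec`, isotropies `hisoKum`, `hisoOrd`, `hisoTr`, (Perf) `hperf`; (Line) `hline`; (Supply)
`hSupply` (level-`n` structure spelled out: Kummer at the infinite places and at the finite places above no prime of
`n`,
ordinary above `n`, transverse on `T`, free at `ℓ`); stub A's (A1) `hA1`; parity `hodd`; `3 ≤ dim` `h3`.
[cite: WZhang2014, §9 proof of Thm. 9.1, Lemma 8.4, §8.1] [cite: MilneADT2006, Ch. I, Thm. 4.10] -/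
theorem inductionOfLevelSystems_of_localGlobal (hK : IsImaginaryQuadratic K)
    (hmult : W.HasMultiplicativeReductionAtPrime 3) (hsurj : W.HasSurjectiveModNGaloisRep 3) (hc : c ≠ 1)
    (S : LevelKolyvaginSystem W K Dt β ι c)
    -- the genuine localisations, as `ZMod 3`-linear maps
    (loc : (v : Place K) → V3 W K →ₗ[ZMod 3]
      galoisCohomology (((W.baseChange K).torsionGaloisModule ((3 ^ 1 : ℕ) : ℤ)).toLocal v) 1)
    (hloc : ∀ (v : Place K) (x : V3 W K),
      loc v x = galoisCohomology.localization ((W.baseChange K).torsionGaloisModule ((3 ^ 1 : ℕ) : ℤ)) v 1 x)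
    -- the places of the Kolyvagin ∕ unipotent-admissible primes
    (plK : {ℓ // Zhang2014.IsKolyvaginPrime (W.conductorNorm ℤ) W K 3 ℓ} → HeightOneSpectrum (𝓞 K))
    (plU : {q // IsUAdmissiblePrime W K q} → HeightOneSpectrum (𝓞 K))
    (hplK : ∀ ℓ, ((ℓ : ℕ) : 𝓞 K) ∈ (plK ℓ).asIdeal) (hplU : ∀ q, ((q : ℕ) : 𝓞 K) ∈ (plU q).asIdeal)
    -- the local Tate-pairing package
    (b : (v : Place K) →
      galoisCohomology (((W.baseChange K).torsionGaloisModule ((3 ^ 1 : ℕ) : ℤ)).toLocal v) 1 →ₗ[ZMod 3]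
      galoisCohomology (((W.baseChange K).torsionGaloisModule ((3 ^ 1 : ℕ) : ℤ)).toLocal v) 1 →ₗ[ZMod 3] ZMod 3)
    (hrec : ∀ (x y : V3 W K) (T : Finset (Place K)), (∀ v, v ∉ T → b v (loc v x) (loc v y) = 0) →
      ∑ v ∈ T, b v (loc v x) (loc v y) = 0)
    (hisoKum : ∀ (v : Place K),
      ∀ x ∈ (W.baseChange K).kummerLocalConditionAt ((3 ^ 1 : ℕ) : ℤ) (Place.Completion v),
      ∀ y ∈ (W.baseChange K).kummerLocalConditionAt ((3 ^ 1 : ℕ) : ℤ) (Place.Completion v), b v x y = 0)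
    (hisoOrd : ∀ (v : HeightOneSpectrum (𝓞 K)) (x y : V3 W K),
      x ∈ (W.baseChange K).ordinaryLocalKer (v.adicCompletion K) ((3 ^ 1 : ℕ) : ℤ) →
      y ∈ (W.baseChange K).ordinaryLocalKer (v.adicCompletion K) ((3 ^ 1 : ℕ) : ℤ) →
      b (Sum.inr v) (loc (Sum.inr v) x) (loc (Sum.inr v) y) = 0)
    (hisoTr : ∀ (ℓ : {ℓ // Zhang2014.IsKolyvaginPrime (W.conductorNorm ℤ) W K 3 ℓ}) (x y : V3 W K),
      x ∈ transverseLocalKer W K ι ℓ (plK ℓ) → y ∈ transverseLocalKer W K ι ℓ (plK ℓ) →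
      b (Sum.inr (plK ℓ)) (loc (Sum.inr (plK ℓ)) x) (loc (Sum.inr (plK ℓ)) y) = 0)
    (hperf : ∀ (ℓ : {ℓ // Zhang2014.IsKolyvaginPrime (W.conductorNorm ℤ) W K 3 ℓ}) (s : Bool) (x y : V3 W K),
      conjAct W c ((3 ^ 1 : ℕ) : ℤ) x = sgn s • x → conjAct W c ((3 ^ 1 : ℕ) : ℤ) y = sgn s • y →
      x ∈ selmerLocalKer (W.baseChange K) ((plK ℓ).adicCompletion K) ((3 ^ 1 : ℕ) : ℤ) →
      x ∉ (W.baseChange K).torsionLocalKer ((plK ℓ).adicCompletion K) ((3 ^ 1 : ℕ) : ℤ) →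
      y ∈ transverseLocalKer W K ι ℓ (plK ℓ) →
      y ∉ (W.baseChange K).torsionLocalKer ((plK ℓ).adicCompletion K) ((3 ^ 1 : ℕ) : ℤ) →
      b (Sum.inr (plK ℓ)) (loc (Sum.inr (plK ℓ)) x) (loc (Sum.inr (plK ℓ)) y) ≠ 0)
    -- (Line): the Kummer eigen-line at a Kolyvagin prime
    (hline : ∀ (ℓ : {ℓ // Zhang2014.IsKolyvaginPrime (W.conductorNorm ℤ) W K 3 ℓ}) (s : Bool),
      ∃ e : galoisCohomology (((W.baseChange K).torsionGaloisModule ((3 ^ 1 : ℕ) : ℤ)).toLocal (Sum.inr (plK ℓ))) 1,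
      ∀ x : V3 W K, conjAct W c ((3 ^ 1 : ℕ) : ℤ) x = sgn s • x →
        x ∈ selmerLocalKer (W.baseChange K) ((plK ℓ).adicCompletion K) ((3 ^ 1 : ℕ) : ℤ) →
        ∃ a : ZMod 3, loc (Sum.inr (plK ℓ)) x = a • e)
    -- (Supply): Zhang's Lemma 8.2 for the level-n structure
    (hSupply : ∀ (n : Finset {q // IsUAdmissiblePrime W K q}), GoodLevel W K n → n.Nonempty →
      ∀ (ℓ : {ℓ // Zhang2014.IsKolyvaginPrime (W.conductorNorm ℤ) W K 3 ℓ}) (T : Finset _), ℓ ∉ T →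
      ∀ s : Bool, ∃ x : V3 W K, conjAct W c ((3 ^ 1 : ℕ) : ℤ) x = sgn s • x ∧ x ≠ 0 ∧
        (∀ w : InfinitePlace K, x ∈ selmerLocalKer (W.baseChange K) w.Completion ((3 ^ 1 : ℕ) : ℤ)) ∧
        (∀ v : HeightOneSpectrum (𝓞 K), v ≠ plK ℓ → (∀ ℓ' ∈ T, plK ℓ' ≠ v) →
          ((∀ q ∈ n, ((q : ℕ) : 𝓞 K) ∉ v.asIdeal) →
            x ∈ selmerLocalKer (W.baseChange K) (v.adicCompletion K) ((3 ^ 1 : ℕ) : ℤ)) ∧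
          (∀ q ∈ n, ((q : ℕ) : 𝓞 K) ∈ v.asIdeal →
            x ∈ (W.baseChange K).ordinaryLocalKer (v.adicCompletion K) ((3 ^ 1 : ℕ) : ℤ))) ∧
        (∀ ℓ' ∈ T, x ∈ transverseLocalKer W K ι ℓ' (plK ℓ')))
    -- (A1) at the frame, the parity and the rank ≥ 3
    (hA1 : ∀ (n : Finset {q // IsUAdmissiblePrime W K q}) (μ : Bool) (x : V3 W K),
      GoodLevel W K n → x ∈ SelQ W K c n μ → x ≠ 0 →
      ∃ q : {q // IsUAdmissiblePrime W K q}, q ∉ n ∧ GoodLevel W K (insert q n) ∧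
        x ∉ SelQ W K c (insert q n) μ ∧
        SelQ W K c (insert q n) μ ≤ SelQ W K c n μ ∧
        finrank (ZMod 3) (SelQ W K c (insert q n) μ) + 1 = finrank (ZMod 3) (SelQ W K c n μ) ∧
        SelQ W K c (insert q n) (!μ) = SelQ W K c n (!μ))
    (hodd : Odd (finrank (ZMod 3)
      (AddSubgroup.toZModSubmodule 3 (selmerGroup (W.baseChange K) ((3 ^ 1 : ℕ) : ℤ)))))
    (h3 : 3 ≤ finrank (ZMod 3)
      (AddSubgroup.toZModSubmodule 3 (selmerGroup (W.baseChange K) ((3 ^ 1 : ℕ) : ℤ)))) :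
    ∃ (n : ℕ) (d : KolyvaginHeegnerData Dt β ι n),
      KolyvaginDescent.KolSupp (Zhang2014.IsKolyvaginPrime (W.conductorNorm ℤ) W K 3) n ∧
        d.kolyvaginClass Nat.prime_three 1 ≠ 0 := by
  -- the concrete apparatus: eigenspaces, local conditions as `ZMod 3`-subspaces, level structure
  let ρ := (W.baseChange K).torsionGaloisModule ((3 ^ 1 : ℕ) : ℤ)
  let E : Bool → Submodule (ZMod 3) (V3 W K) := fun s ↦
    AddSubgroup.toZModSubmodule 3 (conjAct W c ((3 ^ 1 : ℕ) : ℤ) - sgn s • AddMonoidHom.id (V3 W K)).ker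
  have hE : ∀ (s : Bool) (x : V3 W K), x ∈ E s ↔ conjAct W c ((3 ^ 1 : ℕ) : ℤ) x = sgn s • x :=
    fun s x ↦ mem_eigenSubmodule_iff W K c s x
  let Kum : (v : Place K) → Submodule (ZMod 3) (galoisCohomology (ρ.toLocal v) 1) := fun v ↦
    AddSubgroup.toZModSubmodule 3 ((W.baseChange K).kummerLocalConditionAt ((3 ^ 1 : ℕ) : ℤ) (Place.Completion v))
  let Ord : (v : HeightOneSpectrum (𝓞 K)) → Submodule (ZMod 3) (galoisCohomology (ρ.toLocal (Sum.inr v)) 1) :=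
    fun v ↦ Submodule.map (loc (Sum.inr v))
      (AddSubgroup.toZModSubmodule 3 ((W.baseChange K).ordinaryLocalKer (v.adicCompletion K) ((3 ^ 1 : ℕ) : ℤ)))
  let Tr : (ℓ : {ℓ // Zhang2014.IsKolyvaginPrime (W.conductorNorm ℤ) W K 3 ℓ}) →
      Submodule (ZMod 3) (galoisCohomology (ρ.toLocal (Sum.inr (plK ℓ))) 1) := fun ℓ ↦
    Submodule.map (loc (Sum.inr (plK ℓ))) (AddSubgroup.toZModSubmodule 3 (transverseLocalKer W K ι ℓ (plK ℓ)))
  let L : Finset {q // IsUAdmissiblePrime W K q} → (v : Place K) → Submodule (ZMod 3) (galoisCohomology (ρ.toLocal v)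
      1) :=
    fun n v ↦ match v with
      | Sum.inl w => Kum (Sum.inl w)
      | Sum.inr v' => if ∃ q ∈ n, ((q : ℕ) : 𝓞 K) ∈ v'.asIdeal then Ord v' else Kum (Sum.inr v')
  -- per-place dictionaries for the genuine localisations
  have hZero : ∀ (v : HeightOneSpectrum (𝓞 K)) (x : V3 W K),
      x ∈ (W.baseChange K).torsionLocalKer (v.adicCompletion K) ((3 ^ 1 : ℕ) : ℤ) ↔ loc (Sum.inr v) x = 0 := by
    intro v x; rw [hloc]; exact mem_torsionLocalKer_iff_localization_eq_zero W K v x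
  have hKumFin : ∀ (v : HeightOneSpectrum (𝓞 K)) (x : V3 W K),
      x ∈ selmerLocalKer (W.baseChange K) (v.adicCompletion K) ((3 ^ 1 : ℕ) : ℤ) ↔ loc (Sum.inr v) x ∈ Kum (Sum.inr
          v) := by
    intro v x
    rw [AddSubgroup.mem_toZModSubmodule, hloc]
    exact mem_selmerLocalKer_iff_localization_mem_kummer W K v x
  have hKumInf : ∀ (w : InfinitePlace K) (x : V3 W K),
      x ∈ selmerLocalKer (W.baseChange K) w.Completion ((3 ^ 1 : ℕ) : ℤ) ↔ loc (Sum.inl w) x ∈ Kum (Sum.inl w) := by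
    intro w x
    rw [AddSubgroup.mem_toZModSubmodule, hloc]
    exact mem_selmerLocalKer_iff_localization_mem_kummer_inf W K w x
  -- a subspace containing the kernel is the preimage of its image (for the linear `loc`)
  have hmap : ∀ (v : HeightOneSpectrum (𝓞 K)) (H : AddSubgroup (V3 W K)),
      (W.baseChange K).torsionLocalKer (v.adicCompletion K) ((3 ^ 1 : ℕ) : ℤ) ≤ H → ∀ x : V3 W K,
      x ∈ H ↔ loc (Sum.inr v) x ∈ Submodule.map (loc (Sum.inr v)) (AddSubgroup.toZModSubmodule 3 H) := by
    intro v H hH x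
    refine ⟨fun hx ↦ Submodule.mem_map_of_mem (by rwa [AddSubgroup.mem_toZModSubmodule]), fun hx ↦ ?_⟩
    obtain ⟨y, hy, hyx⟩ := Submodule.mem_map.mp hx
    rw [AddSubgroup.mem_toZModSubmodule] at hy
    have hk : x - y ∈ (W.baseChange K).torsionLocalKer (v.adicCompletion K) ((3 ^ 1 : ℕ) : ℤ) := by
      rw [hZero, map_sub, hyx, sub_self]
    have := H.add_mem (hH hk) hy
    rwa [sub_add_cancel] at this
  have hOrd : ∀ (v : HeightOneSpectrum (𝓞 K)) (x : V3 W K),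
      x ∈ (W.baseChange K).ordinaryLocalKer (v.adicCompletion K) ((3 ^ 1 : ℕ) : ℤ) ↔ loc (Sum.inr v) x ∈ Ord v := by
    intro v x
    refine hmap v _ (fun y hy ↦ ?_) x
    change (W.baseChange K).torsionLocMap (v.adicCompletion K) _ y = 0 at hy
    change y ∈ AddSubgroup.comap _ _
    rw [AddSubgroup.mem_comap, hy]
    exact AddSubgroup.zero_mem _
  have hTr : ∀ (ℓ : {ℓ // Zhang2014.IsKolyvaginPrime (W.conductorNorm ℤ) W K 3 ℓ}) (x : V3 W K),
      x ∈ transverseLocalKer W K ι ℓ (plK ℓ) ↔ loc (Sum.inr (plK ℓ)) x ∈ Tr ℓ :=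
    fun ℓ x ↦ hmap (plK ℓ) _ (torsionLocalKer_le_transverseLocalKer W K ι ℓ (plK ℓ)) x
  -- the level structure
  have hLinf : ∀ (n : Finset {q // IsUAdmissiblePrime W K q}) (w : InfinitePlace K), L n (Sum.inl w) = Kum (Sum.inl
      w) :=
    fun n w ↦ rfl
  have hLkum : ∀ (n : Finset {q // IsUAdmissiblePrime W K q}) (v : HeightOneSpectrum (𝓞 K)),
      (∀ q ∈ n, ((q : ℕ) : 𝓞 K) ∉ v.asIdeal) → L n (Sum.inr v) = Kum (Sum.inr v) := by
    intro n v hv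
    have hneg : ¬ ∃ q ∈ n, ((q : ℕ) : 𝓞 K) ∈ v.asIdeal := fun ⟨q, hq, hqv⟩ ↦ hv q hq hqv
    show (if ∃ q ∈ n, ((q : ℕ) : 𝓞 K) ∈ v.asIdeal then Ord v else Kum (Sum.inr v)) = Kum (Sum.inr v)
    rw [if_neg hneg]
  have hLord : ∀ (n : Finset {q // IsUAdmissiblePrime W K q}) (v : HeightOneSpectrum (𝓞 K)), ∀ q ∈ n,
      ((q : ℕ) : 𝓞 K) ∈ v.asIdeal → L n (Sum.inr v) = Ord v := by
    intro n v q hq hqv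
    show (if ∃ q ∈ n, ((q : ℕ) : 𝓞 K) ∈ v.asIdeal then Ord v else Kum (Sum.inr v)) = Ord v
    rw [if_pos ⟨q, hq, hqv⟩]
  -- isotropy of the level structure and of the transverse conditions
  have hisoL : ∀ (n : Finset {q // IsUAdmissiblePrime W K q}) (v : Place K), ∀ x ∈ L n v, ∀ y ∈ L n v, b v x y = 0 := by
    intro n v x hx y hy
    rcases v with w | v
    · change x ∈ AddSubgroup.toZModSubmodule 3 _ at hx
      change y ∈ AddSubgroup.toZModSubmodule 3 _ at hy
      rw [AddSubgroup.mem_toZModSubmodule] at hx hy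
      exact hisoKum (Sum.inl w) x hx y hy
    · by_cases h : ∃ q ∈ n, ((q : ℕ) : 𝓞 K) ∈ v.asIdeal
      · obtain ⟨q, hq, hqv⟩ := h
        rw [hLord n v q hq hqv] at hx hy
        obtain ⟨x', hx', rfl⟩ := Submodule.mem_map.mp hx
        obtain ⟨y', hy', rfl⟩ := Submodule.mem_map.mp hy
        rw [AddSubgroup.mem_toZModSubmodule] at hx' hy'
        exact hisoOrd v x' y' hx' hy'
      · push Not at h
        rw [hLkum n v h] at hx hy
        change x ∈ AddSubgroup.toZModSubmodule 3 _ at hx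
        change y ∈ AddSubgroup.toZModSubmodule 3 _ at hy
        rw [AddSubgroup.mem_toZModSubmodule] at hx hy
        exact hisoKum (Sum.inr v) x hx y hy
  have hisoT : ∀ (ℓ : {ℓ // Zhang2014.IsKolyvaginPrime (W.conductorNorm ℤ) W K 3 ℓ}), ∀ x ∈ Tr ℓ, ∀ y ∈ Tr ℓ,
      b (Sum.inr (plK ℓ)) x y = 0 := by
    intro ℓ x hx y hy
    obtain ⟨x', hx', rfl⟩ := Submodule.mem_map.mp hx
    obtain ⟨y', hy', rfl⟩ := Submodule.mem_map.mp hy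
    rw [AddSubgroup.mem_toZModSubmodule] at hx' hy'
    exact hisoTr ℓ x' y' hx' hy'
  -- (Perf) and (Line) in engine currency
  have hperf' : ∀ (ℓ : {ℓ // Zhang2014.IsKolyvaginPrime (W.conductorNorm ℤ) W K 3 ℓ}) (s : Bool),
      ∀ x ∈ E s, ∀ y ∈ E s, loc (Sum.inr (plK ℓ)) x ∈ Kum (Sum.inr (plK ℓ)) → loc (Sum.inr (plK ℓ)) x ≠ 0 →
      loc (Sum.inr (plK ℓ)) y ∈ Tr ℓ → loc (Sum.inr (plK ℓ)) y ≠ 0 →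
      b (Sum.inr (plK ℓ)) (loc (Sum.inr (plK ℓ)) x) (loc (Sum.inr (plK ℓ)) y) ≠ 0 := by
    intro ℓ s x hx y hy hxK hx0 hyT hy0
    refine hperf ℓ s x y ((hE s x).mp hx) ((hE s y).mp hy) ((hKumFin _ x).mpr hxK)
      (fun h ↦ hx0 ((hZero _ x).mp h)) ((hTr ℓ y).mpr hyT) (fun h ↦ hy0 ((hZero _ y).mp h))
  have hline' : ∀ (ℓ : {ℓ // Zhang2014.IsKolyvaginPrime (W.conductorNorm ℤ) W K 3 ℓ}) (s : Bool),
      ∃ e : galoisCohomology (ρ.toLocal (Sum.inr (plK ℓ))) 1, ∀ x ∈ E s,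
      loc (Sum.inr (plK ℓ)) x ∈ Kum (Sum.inr (plK ℓ)) → ∃ a : ZMod 3, loc (Sum.inr (plK ℓ)) x = a • e := by
    intro ℓ s
    obtain ⟨e, he⟩ := hline ℓ s
    exact ⟨e, fun x hx hxK ↦ he x ((hE s x).mp hx) ((hKumFin _ x).mpr hxK)⟩
  -- (Cheb) ×2 from McCallum's Cor. 3.2
  have hCheb1 := cheb_one_of_mcCallum W K c hK hmult hsurj hc loc plK hplK hZero
  have hCheb2 := cheb_two_of_mcCallum W K c hK hmult hsurj hc loc E plK hplK hE hZero
  -- (Supply) in engine currency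
  have hSupply' : ∀ (n : Finset {q // IsUAdmissiblePrime W K q}), GoodLevel W K n → n.Nonempty →
      ∀ (ℓ : {ℓ // Zhang2014.IsKolyvaginPrime (W.conductorNorm ℤ) W K 3 ℓ}) (T : Finset _), ℓ ∉ T →
      ∀ s : Bool, ∃ x ∈ E s, x ≠ 0 ∧
        (∀ v : Place K, v ≠ Sum.inr (plK ℓ) → (∀ ℓ' ∈ T, Sum.inr (plK ℓ') ≠ v) → loc v x ∈ L n v) ∧
        ∀ ℓ' ∈ T, loc (Sum.inr (plK ℓ')) x ∈ Tr ℓ' := by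
    intro n hg hn ℓ T hℓT s
    obtain ⟨x, hxs, hx0, hinf, hfin, htr⟩ := hSupply n hg hn ℓ T hℓT s
    refine ⟨x, (hE s x).mpr hxs, hx0, fun v hv hvT ↦ ?_, fun ℓ' hℓ' ↦ (hTr ℓ' x).mp (htr ℓ' hℓ')⟩
    rcases v with w | v
    · show loc (Sum.inl w) x ∈ Kum (Sum.inl w)
      exact (hKumInf w x).mp (hinf w)
    · have hv' : v ≠ plK ℓ := fun h ↦ hv (by rw [h])
      have hvT' : ∀ ℓ' ∈ T, plK ℓ' ≠ v := fun ℓ' hℓ'T h ↦ hvT ℓ' hℓ'T (by rw [h])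
      obtain ⟨hk, ho⟩ := hfin v hv' hvT'
      by_cases h : ∃ q ∈ n, ((q : ℕ) : 𝓞 K) ∈ v.asIdeal
      · obtain ⟨q, hq, hqv⟩ := h
        rw [hLord n v q hq hqv]; exact (hOrd v x).mp (ho q hq hqv)
      · push Not at h
        rw [hLkum n v h]; exact (hKumFin v x).mp (hk h)
  exact inductionOfLevelSystems_of_dictionaries W K Dt β ι c hK S loc b E Kum Ord plK plU Tr L hplK hplU hE hKumInf
    hKumFin hOrd hTr hZero hLinf hLkum hLord hisoL hisoT hperf' hline' hrec hCheb1 hCheb2 hSupply' hA1 hodd h3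

end Summit.BirchSwinnertonDyer.Rank1Residual.X11b.Three.Koly.Method2

end
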